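import Mathlib
import Literature.Probability.Percolation.Percolation
import HarnessLib

/-!
# QUANT lane R8, front "FAR beyond trees", layer one — the BUNDLE DICHOTOMY, graph side I: reachability around a pendant bundle

builds on p205010 (kernel theorem, internal audit signed; external expert review pending)

Support file (`--supports stmt-CriticalPhenomena-4575`), seat `prim-quant-p1` (gen 18); memo
`run/shared/lean/prim/quant/prim-quant-p1-g18/FOR-LEAD-UNICYCLIC-TREES.md` §1 (kernel plan §6, file F-B part 1).
Pure combinatorics of open paths (no measure); standard axioms; no sorries.

**Setting.**  Vertices `Fin n`; a configuration `ω : BondConfig (Fin n)` (set of open pairs); observer `o`; a POCKET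
`Z = insert u Lf` consisting of a bundle vertex `u` and its pendant leaves `Lf` (`u ∉ Lf`), a parent `p ∉ Z`, `o ∉ Z`, and a marked leaf
`ℓ₁ ∈ Lf`.  The configuration is GOOD (`Bundle.Good`) if every open non-diagonal pair meeting `Z` is one of the ALLOWED pairs
`s(p,u)`, `s(p,ℓ₁)`, `s(u,ℓ)` (`ℓ ∈ Lf`) — almost surely the case when all other pairs at `Z` carry weight `0` (file F-B part 2).
This covers simultaneously the current bundle (`s(p,ℓ₁)` closed), the DETACHED one (`s(u,ℓ₁)` closed) and the GLUED one.

* `Bundle.offZ Z ω` — the open pairs avoiding `Z`;  `Bundle.connU`, `Bundle.pocket` — the explicit pocket connectivity predicates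
  (`u` is joined to `p` inside the pocket; leaf `ℓ` is joined to `p` inside the pocket);
* `Bundle.inv_of_walk` — the walk invariant;  **`Bundle.reach_iff_offZ`**: for `a ∉ Z`, `o ↔ a` in `ω` iff `o ↔ a` off `Z`;
  **`Bundle.reach_leaf_iff`**: for `ℓ ∈ Lf`, `o ↔ ℓ` iff (`o ↔ p` off `Z`) and `pocket ℓ`;
* `Bundle.card_filter_eq` — hence `#{a ∈ A : o ↔ a} = #{a ∈ A ∖ Lf : o ↔ a off Z} + 𝟙[o ↔ p off Z] · #{ℓ ∈ Lf : pocket ℓ}` for `Lf ⊆ A ∌ u`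
  (the decomposition `N = N_rest + J · X` of memo §1).
[cite: Grimmett1999, §1.3 p. 10] (open paths / clusters); the bookkeeping is [this work].
-/

namespace Summit.CriticalPhenomena.PercolationContinuityZ3.Theorems

namespace Quant

namespace Bundle

open Finset
open Literature.Probability.Percolation
open scoped Classical

variable {n : ℕ}

/-! ## The pocket data and predicates -/

/-- The open pairs avoiding the pocket `Z`. [this work] -/
def offZ (Z : Finset (Fin n)) (ω : BondConfig (Fin n)) : BondConfig (Fin n) := {e | e ∈ ω ∧ ∀ z ∈ Z, z ∉ e}

/-- `offZ Z ω ⊆ ω`. [this work] -/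
theorem offZ_subset (Z : Finset (Fin n)) (ω : BondConfig (Fin n)) : offZ Z ω ⊆ ω := fun _ he => he.1

/-- The allowed pairs at the pocket: `s(p,u)`, `s(p,ℓ₁)`, `s(u,ℓ)` for `ℓ ∈ Lf`. [this work] -/
def Allowed (p u ℓ₁ : Fin n) (Lf : Finset (Fin n)) (e : Sym2 (Fin n)) : Prop :=
  e = s(p, u) ∨ e = s(p, ℓ₁) ∨ ∃ ℓ ∈ Lf, e = s(u, ℓ)

/-- A configuration is GOOD at the pocket if every open non-diagonal pair meeting `Z = insert u Lf` is allowed. [this work] -/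
def Good (p u ℓ₁ : Fin n) (Lf : Finset (Fin n)) (ω : BondConfig (Fin n)) : Prop :=
  ∀ x y : Fin n, x ≠ y → s(x, y) ∈ ω → (x ∈ insert u Lf ∨ y ∈ insert u Lf) → Allowed p u ℓ₁ Lf s(x, y)

/-- `u` is joined to `p` inside the pocket: `s(p,u)` open, or `s(p,ℓ₁)` and `s(u,ℓ₁)` open. [this work] -/
def connU (p u ℓ₁ : Fin n) (ω : BondConfig (Fin n)) : Prop := s(p, u) ∈ ω ∨ (s(p, ℓ₁) ∈ ω ∧ s(u, ℓ₁) ∈ ω)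

/-- Leaf `ℓ` is joined to `p` inside the pocket: through `u`, or (for `ℓ = ℓ₁`) by the pair `s(p,ℓ₁)`. [this work] -/
def pocket (p u ℓ₁ : Fin n) (ω : BondConfig (Fin n)) (ℓ : Fin n) : Prop :=
  (connU p u ℓ₁ ω ∧ s(u, ℓ) ∈ ω) ∨ (ℓ = ℓ₁ ∧ s(p, ℓ₁) ∈ ω)

/-- The data of a pocket: `p, o ∉ Z = insert u Lf`, `u ∉ Lf`, `ℓ₁ ∈ Lf`. [this work] -/
structure IsPocket (o p u ℓ₁ : Fin n) (Lf : Finset (Fin n)) : Prop where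
  pu : p ≠ u
  pL : p ∉ Lf
  ou : o ≠ u
  oL : o ∉ Lf
  uL : u ∉ Lf
  l1 : ℓ₁ ∈ Lf

section Pocket

variable {o p u ℓ₁ : Fin n} {Lf : Finset (Fin n)} (H : IsPocket o p u ℓ₁ Lf)
include H

/-- The walk invariant: off the pocket a vertex is reached off `Z`; inside the pocket it is reached through `p` and the pocket pairs.
[this work] -/
def Inv (o p u ℓ₁ : Fin n) (Lf : Finset (Fin n)) (ω : BondConfig (Fin n)) (x : Fin n) : Prop :=
  (x ∉ insert u Lf → (openGraph (offZ (insert u Lf) ω)).Reachable o x) ∧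
  (x = u → (openGraph (offZ (insert u Lf) ω)).Reachable o p ∧ connU p u ℓ₁ ω) ∧
  (x ∈ Lf → (openGraph (offZ (insert u Lf) ω)).Reachable o p ∧ pocket p u ℓ₁ ω x)

omit H in
/-- The invariant holds at the observer (`o ∉ Z`). [this work] -/
theorem inv_start (hou : o ≠ u) (hoL : o ∉ Lf) (ω : BondConfig (Fin n)) : Inv o p u ℓ₁ Lf ω o :=
  ⟨fun _ => SimpleGraph.Reachable.refl _, fun h => absurd h hou, fun h => absurd h hoL⟩

/-- One step of the invariant along an open pair of a good configuration. [this work] -/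
theorem inv_step {ω : BondConfig (Fin n)} (hω : Good p u ℓ₁ Lf ω) {x y : Fin n} (hxy : x ≠ y) (he : s(x, y) ∈ ω)
    (hx : Inv o p u ℓ₁ Lf ω x) : Inv o p u ℓ₁ Lf ω y := by
  obtain ⟨hx1, hx2, hx3⟩ := hx
  set Z : Finset (Fin n) := insert u Lf with hZ
  set G := openGraph (offZ Z ω) with hG
  have hpZ : p ∉ Z := by rw [hZ, mem_insert, not_or]; exact ⟨H.pu, H.pL⟩
  by_cases hxZ : x ∈ Z <;> by_cases hyZ : y ∈ Z
  · -- both in the pocket: the pair is `s(u, ℓ)`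
    rcases hω x y hxy he (Or.inl hxZ) with h | h | ⟨ℓ, hℓ, h⟩
    · exact absurd (h ▸ Sym2.mem_mk_left p u : p ∈ s(x, y)) (by
        rw [Sym2.mem_iff, not_or]; exact ⟨fun h' => hpZ (h' ▸ hxZ), fun h' => hpZ (h' ▸ hyZ)⟩)
    · exact absurd (h ▸ Sym2.mem_mk_left p ℓ₁ : p ∈ s(x, y)) (by
        rw [Sym2.mem_iff, not_or]; exact ⟨fun h' => hpZ (h' ▸ hxZ), fun h' => hpZ (h' ▸ hyZ)⟩)
    · rcases Sym2.eq_iff.1 h with ⟨h1, h2⟩ | ⟨h1, h2⟩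
      · -- `u → ℓ`: `x = u`, `y = ℓ`
        subst h1; subst h2
        obtain ⟨hR, hcu⟩ := hx2 rfl
        refine ⟨fun h' => absurd (mem_insert_of_mem hℓ) h', fun h' => absurd (h' ▸ hℓ) H.uL, fun _ => ⟨hR, Or.inl ⟨hcu, he⟩⟩⟩
      · -- `ℓ → u`: `x = ℓ`, `y = u`
        subst h1; subst h2
        obtain ⟨hR, hpk⟩ := hx3 hℓ
        have hcu : connU p y ℓ₁ ω := by
          rcases hpk with ⟨hcu, -⟩ | ⟨h3, hp1⟩
          · exact hcu
          · subst h3; exact Or.inr ⟨hp1, by rw [Sym2.eq_swap]; exact he⟩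
        refine ⟨fun h' => absurd (mem_insert_self _ _) h', fun _ => ⟨hR, hcu⟩, fun h' => absurd h' H.uL⟩
  · -- `x ∈ Z`, `y ∉ Z`: the pair is `s(p,u)` or `s(p,ℓ₁)` read backwards, so `y = p`
    have hyp : y = p := by
      rcases hω x y hxy he (Or.inl hxZ) with h | h | ⟨ℓ, hℓ, h⟩
      · rcases Sym2.eq_iff.1 h with ⟨-, h2⟩ | ⟨-, h2⟩
        · exact absurd (by rw [h2]; exact mem_insert_self u Lf : y ∈ Z) hyZ
        · exact h2
      · rcases Sym2.eq_iff.1 h with ⟨-, h2⟩ | ⟨-, h2⟩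
        · exact absurd (by rw [h2]; exact mem_insert_of_mem H.l1 : y ∈ Z) hyZ
        · exact h2
      · rcases Sym2.eq_iff.1 h with ⟨-, h2⟩ | ⟨-, h2⟩
        · exact absurd (by rw [h2]; exact mem_insert_of_mem hℓ : y ∈ Z) hyZ
        · exact absurd (by rw [h2]; exact mem_insert_self u Lf : y ∈ Z) hyZ
    rw [hyp]
    have hR : G.Reachable o p := by
      rw [hZ, mem_insert] at hxZ
      rcases hxZ with hxu | hxL
      · exact (hx2 hxu).1
      · exact (hx3 hxL).1
    exact ⟨fun _ => hR, fun h' => absurd h' H.pu, fun h' => absurd h' H.pL⟩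
  · -- `x ∉ Z`, `y ∈ Z`: the pair is `s(p,u)` or `s(p,ℓ₁)`, so `x = p`
    have hR : G.Reachable o x := hx1 hxZ
    rcases hω x y hxy he (Or.inr hyZ) with h | h | ⟨ℓ, hℓ, h⟩
    · rcases Sym2.eq_iff.1 h with ⟨h1, h2⟩ | ⟨h1, -⟩
      · -- `x = p`, `y = u`
        subst h2
        exact ⟨fun h' => absurd (mem_insert_self _ _) h', fun _ => ⟨h1 ▸ hR, Or.inl (h1 ▸ he)⟩, fun h' => absurd h' H.uL⟩
      · exact absurd (by rw [h1]; exact mem_insert_self u Lf : x ∈ Z) hxZ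
    · rcases Sym2.eq_iff.1 h with ⟨h1, h2⟩ | ⟨h1, -⟩
      · -- `x = p`, `y = ℓ₁`
        subst h2
        exact ⟨fun h' => absurd (mem_insert_of_mem H.l1) h', fun h' => absurd (h' ▸ H.l1) H.uL,
          fun _ => ⟨h1 ▸ hR, Or.inr ⟨rfl, h1 ▸ he⟩⟩⟩
      · exact absurd (by rw [h1]; exact mem_insert_of_mem H.l1 : x ∈ Z) hxZ
    · rcases Sym2.eq_iff.1 h with ⟨h1, -⟩ | ⟨h1, -⟩
      · exact absurd (by rw [h1]; exact mem_insert_self u Lf : x ∈ Z) hxZ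
      · exact absurd (by rw [h1]; exact mem_insert_of_mem hℓ : x ∈ Z) hxZ
  · -- both off the pocket: an `offZ` pair
    have hR : G.Reachable o x := hx1 hxZ
    have hadj : G.Adj x y := by
      rw [hG, openGraph_adj]
      refine ⟨⟨he, fun z hz hzm => ?_⟩, hxy⟩
      rcases Sym2.mem_iff.1 hzm with rfl | rfl
      · exact hxZ hz
      · exact hyZ hz
    exact ⟨fun _ => hR.trans hadj.reachable, fun h' => absurd (h' ▸ mem_insert_self u Lf : y ∈ Z) hyZ,
      fun h' => absurd (mem_insert_of_mem h' : y ∈ Z) hyZ⟩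

/-- The invariant propagates along open walks of a good configuration. [this work] -/
theorem inv_of_walk {ω : BondConfig (Fin n)} (hω : Good p u ℓ₁ Lf ω) :
    ∀ (x y : Fin n) (_ : (openGraph ω).Walk x y), Inv o p u ℓ₁ Lf ω x → Inv o p u ℓ₁ Lf ω y := by
  intro x y q
  induction q with
  | nil => exact id
  | cons hadj q' ih =>
    intro hx
    rw [openGraph_adj] at hadj
    exact ih (inv_step H hω hadj.2 hadj.1 hx)

/-- The invariant holds at every vertex joined to `o`. [this work] -/
theorem inv_of_reachable {ω : BondConfig (Fin n)} (hω : Good p u ℓ₁ Lf ω) {x : Fin n} (h : (openGraph ω).Reachable o x) :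
    Inv o p u ℓ₁ Lf ω x := by
  obtain ⟨q⟩ := h
  exact inv_of_walk H hω o x q (inv_start H.ou H.oL ω)

omit H in
/-- Paths off the pocket are paths. [this work] -/
theorem reachable_of_offZ {Z : Finset (Fin n)} {ω : BondConfig (Fin n)} {x y : Fin n}
    (h : (openGraph (offZ Z ω)).Reachable x y) : (openGraph ω).Reachable x y :=
  h.mono (SimpleGraph.fromEdgeSet_mono (offZ_subset Z ω))

/-- **Vertices off the pocket are reached off the pocket.**  For `a ∉ Z`: `o ↔ a` in `ω` iff `o ↔ a` in `offZ Z ω`. [this work] -/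
theorem reach_iff_offZ {ω : BondConfig (Fin n)} (hω : Good p u ℓ₁ Lf ω) {a : Fin n} (ha : a ∉ insert u Lf) :
    (openGraph ω).Reachable o a ↔ (openGraph (offZ (insert u Lf) ω)).Reachable o a :=
  ⟨fun h => (inv_of_reachable H hω h).1 ha, reachable_of_offZ⟩

/-- `connU` joins `p` to `u`. [this work] -/
theorem reachable_u_of_connU {ω : BondConfig (Fin n)} (h : connU p u ℓ₁ ω) : (openGraph ω).Reachable p u := by
  rcases h with h | ⟨h1, h2⟩
  · have : (openGraph ω).Adj p u := by rw [openGraph_adj]; exact ⟨h, H.pu⟩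
    exact this.reachable
  · have hpl : p ≠ ℓ₁ := fun h' => H.pL (h' ▸ H.l1)
    have hul : u ≠ ℓ₁ := fun h' => H.uL (h' ▸ H.l1)
    have a1 : (openGraph ω).Adj p ℓ₁ := by rw [openGraph_adj]; exact ⟨h1, hpl⟩
    have a2 : (openGraph ω).Adj ℓ₁ u := by rw [openGraph_adj, Sym2.eq_swap]; exact ⟨h2, hul.symm⟩
    exact a1.reachable.trans a2.reachable

/-- `pocket ℓ` joins `p` to the leaf `ℓ`. [this work] -/
theorem reachable_leaf_of_pocket {ω : BondConfig (Fin n)} {ℓ : Fin n} (hℓ : ℓ ∈ Lf) (h : pocket p u ℓ₁ ω ℓ) :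
    (openGraph ω).Reachable p ℓ := by
  rcases h with ⟨hcu, hul⟩ | ⟨rfl, hp1⟩
  · have hne : u ≠ ℓ := fun h' => H.uL (h' ▸ hℓ)
    have a : (openGraph ω).Adj u ℓ := by rw [openGraph_adj]; exact ⟨hul, hne⟩
    exact (reachable_u_of_connU H hcu).trans a.reachable
  · have hpl : p ≠ ℓ := fun h' => H.pL (h' ▸ H.l1)
    have a : (openGraph ω).Adj p ℓ := by rw [openGraph_adj]; exact ⟨hp1, hpl⟩
    exact a.reachable

/-- **Leaves are reached through the parent and the pocket.**  For `ℓ ∈ Lf`: `o ↔ ℓ` in `ω` iff (`o ↔ p` off `Z`) and `pocket ℓ`.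
[this work] -/
theorem reach_leaf_iff {ω : BondConfig (Fin n)} (hω : Good p u ℓ₁ Lf ω) {ℓ : Fin n} (hℓ : ℓ ∈ Lf) :
    (openGraph ω).Reachable o ℓ ↔ (openGraph (offZ (insert u Lf) ω)).Reachable o p ∧ pocket p u ℓ₁ ω ℓ :=
  ⟨fun h => (inv_of_reachable H hω h).2.2 hℓ, fun ⟨hR, hpk⟩ => (reachable_of_offZ hR).trans (reachable_leaf_of_pocket H hℓ hpk)⟩

/-- **The count decomposition `N = N_rest + J · X`** (memo §1 (D)).  For a relay set `A ⊇ Lf` with `u ∉ A` and a good configuration: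
`#{a ∈ A : o ↔ a} = #{a ∈ A ∖ Lf : o ↔ a off Z} + (if o ↔ p off Z then #{ℓ ∈ Lf : pocket ℓ} else 0)`. [this work] -/
theorem card_filter_eq {ω : BondConfig (Fin n)} (hω : Good p u ℓ₁ Lf ω) {A : Finset (Fin n)} (hLA : Lf ⊆ A) (huA : u ∉ A) :
    (A.filter fun a => ω ∈ openConn o a).card =
      ((A \ Lf).filter fun a => offZ (insert u Lf) ω ∈ openConn o a).card +
        (if offZ (insert u Lf) ω ∈ openConn o p then (Lf.filter fun ℓ => pocket p u ℓ₁ ω ℓ).card else 0) := by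
  have hsplit : (A.filter fun a => ω ∈ openConn o a) =
      ((A \ Lf).filter fun a => ω ∈ openConn o a) ∪ (Lf.filter fun a => ω ∈ openConn o a) := by
    rw [← filter_union, sdiff_union_of_subset hLA]
  have hdisj : Disjoint ((A \ Lf).filter fun a => ω ∈ openConn o a) (Lf.filter fun a => ω ∈ openConn o a) :=
    disjoint_filter_filter sdiff_disjoint
  rw [hsplit, card_union_of_disjoint hdisj]
  congr 1
  · -- relays off the pocket
    refine congrArg _ (filter_congr fun a ha => ?_)
    have haZ : a ∉ insert u Lf := by
      rw [mem_insert, not_or]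
      exact ⟨fun h => huA (h ▸ (mem_sdiff.1 ha).1), (mem_sdiff.1 ha).2⟩
    exact reach_iff_offZ H hω haZ
  · -- leaves
    by_cases hR : offZ (insert u Lf) ω ∈ openConn o p
    · rw [if_pos hR]
      refine congrArg _ (filter_congr fun ℓ hℓ => ?_)
      rw [show (ω ∈ openConn o ℓ) = (openGraph ω).Reachable o ℓ from rfl, reach_leaf_iff H hω hℓ]
      exact ⟨fun h => h.2, fun h => ⟨hR, h⟩⟩
    · rw [if_neg hR, card_eq_zero, filter_eq_empty_iff]
      intro ℓ hℓ h
      exact hR ((reach_leaf_iff H hω hℓ).1 h).1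

end Pocket

end Bundle

end Quant

end Summit.CriticalPhenomena.PercolationContinuityZ3.Theorems
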